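import Literature.Probability.RandomPlanarGeometry.HexSAWRotSurfaceYc
import Literature.Probability.RandomPlanarGeometry.HexSAWSurfaceYc
import Literature.Probability.RandomPlanarGeometry.HexSAWEndpointKesten
import HarnessLib

/-!
# Beaton's rotated critical surface fugacity `y† = 2.455…`: certified bounds, `1 + √2 < y† < μ² = 2 + √2`, and
# the comparison of the two honeycomb orientations `y_c(zig-zag) = 1 + √2 < y_c(armchair) = y†`

Topic `Literature/Probability/RandomPlanarGeometry` (lane «pcv-sawmu», rotated-door lineage; a numeral rider on the two doors
`HexSAWSurfaceYc.lean` — `HV.hexSurfaceYc_eq : y_c = 1 + √2` (Beaton–Bousquet-Mélou–de Gier–Duminil-Copin–Guttmann) — and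
`HexSAWRotSurfaceYc.lean` — `HV.hexRotSurfaceYc_eq : y_c^rot = y†` (Beaton) —, with `HV.rotYdagger_eq_printed :
y† = √((2+√2)/(1+√2−√(2+√2)))` from `HexSAWRotStripIdentityY.lean` and `μ = x_c⁻¹ = √(2+√2)` from `HexSAWHammersleyWelshExplicit.lean`).

Sources.  N. R. Beaton, J. Phys. A 47 (2014) 075003 = arXiv:1210.0274v3: Theorem 1 (p. 2: "y_c = √((2+√2)/(1+√2−√(2+√2))) = 2.455…"),
Proposition 7 (p. 11: "This implies the existence of a critical value y_c, with 1 ≤ y_c ≤ μ²"), and §1 (p. 2: the value for the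
original orientation is `1 + √2`, citing BBdGDCG).  N. R. Beaton, M. Bousquet-Mélou, J. de Gier, H. Duminil-Copin, A. J. Guttmann,
CMP 326 (2014) 727, Theorem 2 (`y_c = 1 + √2`; arXiv v5 p. 3).  H. Duminil-Copin, S. Smirnov, Ann. Math. 175 (2012) 1653, Theorem 1 (`μ = √(2+√2)`).

What is proved (namespace `Literature.Probability.RandomPlanarGeometry.SAW.HV`; everything is elementary algebra in `√2` and
`√(2+√2)` on top of the three tree identities just named — no trigonometric numerics):

* `one_add_sqrt_two_sub_sqrt_pos : 0 < 1 + √2 − √(2+√2)`, `rotYdagger_sq : y†² = (2+√2)/(1+√2−√(2+√2))`;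
* **`one_add_sqrt_two_lt_rotYdagger : 1 + √2 < y†`** and **`rotYdagger_lt_two_add_sqrt_two : y† < 2 + √2`**,
  `rotYdagger_lt_hexConnectiveConstant_sq : y† < μ²` (Proposition 7's printed `y_c ≤ μ²`, strictly);
* certified enclosure of the printed `2.455…`: `sqrt_six_lt_rotYdagger : √6 < y†` (`√6 = 2.449…`), `rotYdagger_lt_five_halves : y† < 5/2`;
  (EDITION 2, appended) the four printed digits: **`rotYdagger_mem_Ioo_digits : y† ∈ (2.455, 2.4551)`**, `hexRotSurfaceYc_mem_Ioo_digits`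
  (from `1.41421356 < √2 < 1.41421357`);
* **`hexSurfaceYc_lt_hexRotSurfaceYc : y_c < y_c^rot`** — adsorption at the armchair (rotated) boundary of the honeycomb lattice needs a
  STRICTLY larger surface fugacity than at the zig-zag boundary —, `hexRotSurfaceYc_lt_hexConnectiveConstant_sq : y_c^rot < μ²`,
  `one_lt_hexSurfaceYc_and_lt : 1 < y_c ∧ y_c < y_c^rot ∧ y_c^rot < μ²` (the chain `1 < 1+√2 < y† < 2+√2`).

Status in print / LABEL (author's proposal): the two critical values and `μ` are PRINTED theorems (tree theorems here); `1 ≤ y_c ≤ μ²` is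
PRINTED (Prop. 7); the decimal `2.455…` is PRINTED; the strict comparison `1 + √2 < y†` between the two orientations is stated
numerically in Beaton's introduction (p. 2) — this file makes all of them kernel facts by exact algebra.  CONSOLIDATION (numeral XS);
nothing new is claimed.
EDITIONS: ed.1 8eb949dbeb75301f (landed p374967, commit 95de731b258c); ed.2 74bf2e9ceee3b7f1 = ed.1 byte-identical ⊕ the appended section
«the four printed digits» (3 theorems + 1 private lemma); ed.3 (this) = ed.2 with the BBdGDCG theorem number corrected «Theorem 1» → «Theorem 2
(arXiv v5 p. 3)» at four docstring places (lit-1 g18 token YB-2) — DOCSTRING-ONLY, code byte-identical.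
-/

noncomputable section

open Real

namespace Literature.Probability.RandomPlanarGeometry.SAW.HV

/-! ### Algebra of `s = √2` and `u = √(2+√2)` -/

/-- `√2 ² = 2`, `1 < √2 < 3/2`. [folklore] -/
private theorem sqrt_two_facts : Real.sqrt 2 ^ 2 = 2 ∧ 1 < Real.sqrt 2 ∧ Real.sqrt 2 < 3 / 2 := by
  refine ⟨Real.sq_sqrt (by norm_num), ?_, ?_⟩
  · rw [show (1 : ℝ) = Real.sqrt 1 by rw [Real.sqrt_one]]
    exact Real.sqrt_lt_sqrt (by norm_num) (by norm_num)
  · rw [Real.sqrt_lt' (by norm_num)]; norm_num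

/-- `u = √(2+√2)`: `u² = 2 + √2`, `0 < u`, `u < 1 + √2`. [folklore] -/
private theorem sqrt_two_add_facts :
    Real.sqrt (2 + Real.sqrt 2) ^ 2 = 2 + Real.sqrt 2 ∧ 0 < Real.sqrt (2 + Real.sqrt 2) ∧
      Real.sqrt (2 + Real.sqrt 2) < 1 + Real.sqrt 2 := by
  obtain ⟨hs2, hs1, -⟩ := sqrt_two_facts
  have hs0 : 0 < Real.sqrt 2 := by linarith
  refine ⟨Real.sq_sqrt (by positivity), Real.sqrt_pos.2 (by positivity), ?_⟩
  rw [Real.sqrt_lt' (by positivity)]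
  nlinarith

/-- **`1 + √2 − √(2+√2) > 0`** (the radicand of the printed `y†` is positive). [cite: Beaton2014RotatedHoneycomb, Theorem 1 (arXiv v3 p. 2: y_c = √((2+√2)/(1+√2−√(2+√2))))] -/
theorem one_add_sqrt_two_sub_sqrt_pos : 0 < 1 + Real.sqrt 2 - Real.sqrt (2 + Real.sqrt 2) := by
  obtain ⟨-, -, hu⟩ := sqrt_two_add_facts
  linarith

/-- **`y†² = (2+√2)/(1+√2−√(2+√2))`.** [cite: Beaton2014RotatedHoneycomb, Theorem 1 (arXiv v3 p. 2), §4 (p. 16: y†)] -/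
theorem rotYdagger_sq : rotYdagger ^ 2 = (2 + Real.sqrt 2) / (1 + Real.sqrt 2 - Real.sqrt (2 + Real.sqrt 2)) := by
  obtain ⟨-, hs1, -⟩ := sqrt_two_facts
  rw [rotYdagger_eq_printed, Real.sq_sqrt (div_pos (by linarith) one_add_sqrt_two_sub_sqrt_pos).le]

/-- For `a ≥ 0`: `a < y† ↔ a² (1+√2−√(2+√2)) < 2 + √2`. [cite: Beaton2014RotatedHoneycomb, Theorem 1 (arXiv v3 p. 2)] -/
private theorem lt_rotYdagger_iff {a : ℝ} (ha : 0 ≤ a) :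
    a < rotYdagger ↔ a ^ 2 * (1 + Real.sqrt 2 - Real.sqrt (2 + Real.sqrt 2)) < 2 + Real.sqrt 2 := by
  have hd := one_add_sqrt_two_sub_sqrt_pos
  rw [← pow_lt_pow_iff_left₀ ha rotYdagger_pos.le two_ne_zero, rotYdagger_sq, lt_div_iff₀ hd]

/-- For `a ≥ 0`: `y† < a ↔ 2 + √2 < a² (1+√2−√(2+√2))`. [cite: Beaton2014RotatedHoneycomb, Theorem 1 (arXiv v3 p. 2)] -/
private theorem rotYdagger_lt_iff {a : ℝ} (ha : 0 ≤ a) :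
    rotYdagger < a ↔ 2 + Real.sqrt 2 < a ^ 2 * (1 + Real.sqrt 2 - Real.sqrt (2 + Real.sqrt 2)) := by
  have hd := one_add_sqrt_two_sub_sqrt_pos
  rw [← pow_lt_pow_iff_left₀ rotYdagger_pos.le ha two_ne_zero, rotYdagger_sq, div_lt_iff₀ hd]

/-! ### `1 + √2 < y† < 2 + √2 = μ²` -/

/-- **`1 + √2 < y†`**: with `s = √2`, `u = √(2+√2)` this is `5 + 4s < (3+2s) u`, whose squares are `57 + 40s < 58 + 41s`.
[cite: Beaton2014RotatedHoneycomb, §1 (arXiv v3 p. 2: y_c = 2.455… for the rotated orientation vs 1 + √2 for the original one), Theorem 1] -/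
theorem one_add_sqrt_two_lt_rotYdagger : 1 + Real.sqrt 2 < rotYdagger := by
  obtain ⟨hs2, hs1, -⟩ := sqrt_two_facts
  obtain ⟨hu2, hu0, -⟩ := sqrt_two_add_facts
  set s := Real.sqrt 2 with hs
  set u := Real.sqrt (2 + Real.sqrt 2) with hu
  have hs0 : 0 < s := by linarith
  rw [lt_rotYdagger_iff (by linarith)]
  -- `(1+s)²(1+s−u) < 2+s` ⟸ `5 + 4s < (3+2s)u`
  have key : 5 + 4 * s < (3 + 2 * s) * u := by
    have h1 : (5 + 4 * s) ^ 2 < ((3 + 2 * s) * u) ^ 2 := by nlinarith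
    exact lt_of_pow_lt_pow_left₀ 2 (by positivity) h1
  nlinarith

/-- **`y† < 2 + √2`**: `(2+s) u < 3 + 3s`, whose squares are `20 + 14s < 27 + 18s`.
[cite: Beaton2014RotatedHoneycomb, Proposition 7 (arXiv v3 p. 11: "1 ≤ y_c ≤ μ²"), Theorem 1 (p. 2)] -/
theorem rotYdagger_lt_two_add_sqrt_two : rotYdagger < 2 + Real.sqrt 2 := by
  obtain ⟨hs2, hs1, -⟩ := sqrt_two_facts
  obtain ⟨hu2, hu0, -⟩ := sqrt_two_add_facts
  set s := Real.sqrt 2 with hs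
  set u := Real.sqrt (2 + Real.sqrt 2) with hu
  have hs0 : 0 < s := by linarith
  rw [rotYdagger_lt_iff (by linarith)]
  have key : (2 + s) * u < 3 + 3 * s := by
    have h1 : ((2 + s) * u) ^ 2 < (3 + 3 * s) ^ 2 := by nlinarith
    exact lt_of_pow_lt_pow_left₀ 2 (by positivity) h1
  nlinarith

/-- **`y† < μ²`** — Proposition 7's printed upper bound `y_c ≤ μ²`, strictly, for Beaton's `y†`.
[cite: Beaton2014RotatedHoneycomb, Proposition 7 (arXiv v3 p. 11: "with 1 ≤ y_c ≤ μ²"); DuminilCopinSmirnov2012, Theorem 1] -/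
theorem rotYdagger_lt_hexConnectiveConstant_sq : rotYdagger < hexConnectiveConstant ^ 2 := by
  rw [hexConnectiveConstant_sq]; exact rotYdagger_lt_two_add_sqrt_two

/-! ### Certified enclosure of the printed decimal `y† = 2.455…`: `√6 < y† < 5/2` -/

/-- **`√6 < y†`** (`√6 = 2.449…`): `4 + 5s < 6u`, squares `66 + 40s < 72 + 36s`. [cite: Beaton2014RotatedHoneycomb, Theorem 1 (arXiv v3 p. 2: "= 2.455…")] -/
theorem sqrt_six_lt_rotYdagger : Real.sqrt 6 < rotYdagger := by
  obtain ⟨hs2, hs1, hs3⟩ := sqrt_two_facts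
  obtain ⟨hu2, hu0, -⟩ := sqrt_two_add_facts
  set s := Real.sqrt 2 with hs
  set u := Real.sqrt (2 + Real.sqrt 2) with hu
  rw [lt_rotYdagger_iff (Real.sqrt_nonneg 6), Real.sq_sqrt (by norm_num : (0:ℝ) ≤ 6)]
  have key : 4 + 5 * s < 6 * u := by
    have h1 : (4 + 5 * s) ^ 2 < (6 * u) ^ 2 := by nlinarith
    exact lt_of_pow_lt_pow_left₀ 2 (by positivity) h1
  nlinarith

/-- **`y† < 5/2`**: `25u < 17 + 21s`, squares `1250 + 625s < 1171 + 714s` (i.e. `79 < 89s`). [cite: Beaton2014RotatedHoneycomb, Theorem 1 (arXiv v3 p. 2: "= 2.455…")] -/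
theorem rotYdagger_lt_five_halves : rotYdagger < 5 / 2 := by
  obtain ⟨hs2, hs1, hs3⟩ := sqrt_two_facts
  obtain ⟨hu2, hu0, -⟩ := sqrt_two_add_facts
  set s := Real.sqrt 2 with hs
  set u := Real.sqrt (2 + Real.sqrt 2) with hu
  rw [rotYdagger_lt_iff (by norm_num : (0:ℝ) ≤ 5 / 2)]
  have key : 25 * u < 17 + 21 * s := by
    have h1 : (25 * u) ^ 2 < (17 + 21 * s) ^ 2 := by nlinarith
    exact lt_of_pow_lt_pow_left₀ 2 (by positivity) h1
  nlinarith

/-- `y† ∈ (√6, 5/2)`. [cite: Beaton2014RotatedHoneycomb, Theorem 1 (arXiv v3 p. 2: "= 2.455…")] -/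
theorem rotYdagger_mem_Ioo : rotYdagger ∈ Set.Ioo (Real.sqrt 6) (5 / 2) := ⟨sqrt_six_lt_rotYdagger, rotYdagger_lt_five_halves⟩

/-! ### The two orientations compared -/

/-- **`y_c(zig-zag) < y_c(armchair)`**: the critical surface fugacity of honeycomb SAW at the zig-zag boundary (`1 + √2`, BBdGDCG) is
STRICTLY smaller than at Beaton's rotated (armchair) boundary (`y† = 2.455…`).
[cite: Beaton2014RotatedHoneycomb, Theorem 1 (arXiv v3 p. 2) and §1 (p. 2: the original orientation, y_c = 1 + √2); BeatonBousquetMelouDeGierDuminilCopinGuttmann2014, Theorem 2 (arXiv v5 p. 3)] -/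
theorem hexSurfaceYc_lt_hexRotSurfaceYc : hexSurfaceYc < hexRotSurfaceYc := by
  rw [hexSurfaceYc_eq, hexRotSurfaceYc_eq]; exact one_add_sqrt_two_lt_rotYdagger

/-- **`y_c^rot < μ²`** (Proposition 7's `y_c ≤ μ²`, strictly). [cite: Beaton2014RotatedHoneycomb, Proposition 7 (arXiv v3 p. 11: "1 ≤ y_c ≤ μ²")] -/
theorem hexRotSurfaceYc_lt_hexConnectiveConstant_sq : hexRotSurfaceYc < hexConnectiveConstant ^ 2 := by
  rw [hexRotSurfaceYc_eq]; exact rotYdagger_lt_hexConnectiveConstant_sq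

/-- `y_c^rot ∈ (√6, 5/2)` — the printed `2.455…`, certified. [cite: Beaton2014RotatedHoneycomb, Theorem 1 (arXiv v3 p. 2: "y_c = … = 2.455…")] -/
theorem hexRotSurfaceYc_mem_Ioo : hexRotSurfaceYc ∈ Set.Ioo (Real.sqrt 6) (5 / 2) := by
  rw [hexRotSurfaceYc_eq]; exact rotYdagger_mem_Ioo

/-- The chain **`1 < y_c < y_c^rot < μ²`** for the two honeycomb surface orientations.
[cite: Beaton2014RotatedHoneycomb, Proposition 7 (arXiv v3 p. 11: "1 ≤ y_c ≤ μ²"), Theorem 1 (p. 2); BeatonBousquetMelouDeGierDuminilCopinGuttmann2014, Theorem 2 (arXiv v5 p. 3)] -/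
theorem one_lt_hexSurfaceYc_and_lt : 1 < hexSurfaceYc ∧ hexSurfaceYc < hexRotSurfaceYc ∧ hexRotSurfaceYc < hexConnectiveConstant ^ 2 := by
  refine ⟨?_, hexSurfaceYc_lt_hexRotSurfaceYc, hexRotSurfaceYc_lt_hexConnectiveConstant_sq⟩
  obtain ⟨-, hs1, -⟩ := sqrt_two_facts
  rw [hexSurfaceYc_eq]; linarith

/-! ### EDITION 2 — the four printed digits `y† = 2.455…`: `2.455 < y† < 2.4551` -/

/-- `1.41421356 < √2 < 1.41421357`. [folklore] -/
private theorem sqrt_two_digits : (141421356 : ℝ) / 100000000 < Real.sqrt 2 ∧ Real.sqrt 2 < 141421357 / 100000000 := by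
  constructor
  · rw [Real.lt_sqrt (by norm_num)]; norm_num
  · rw [Real.sqrt_lt' (by norm_num)]; norm_num

/-- **`2.455 < y† < 2.4551`** — Beaton's printed decimal `y_c = 2.455…`, certified to its four printed digits (exact algebra in `√2`,
`√(2+√2)` with `1.41421356 < √2 < 1.41421357`). [cite: Beaton2014RotatedHoneycomb, Theorem 1 (arXiv v3 p. 2: "y_c = √((2+√2)/(1+√2−√(2+√2))) = 2.455…")] -/
theorem rotYdagger_mem_Ioo_digits : rotYdagger ∈ Set.Ioo ((2455 : ℝ) / 1000) (24551 / 10000) := by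
  obtain ⟨hs2, hs1, -⟩ := sqrt_two_facts
  obtain ⟨hu2, hu0, hu1⟩ := sqrt_two_add_facts
  obtain ⟨hlo, hhi⟩ := sqrt_two_digits
  set s := Real.sqrt 2 with hs
  set u := Real.sqrt (2 + Real.sqrt 2) with hu
  have hs0 : 0 < s := by linarith
  constructor
  · rw [lt_rotYdagger_iff (by norm_num : (0:ℝ) ≤ 2455 / 1000)]
    -- `a²(1+s) − (2+s) < a² u` by comparing squares
    have hpos : 0 ≤ ((2455 : ℝ) / 1000) ^ 2 * (1 + s) - (2 + s) := by nlinarith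
    have key : ((2455 : ℝ) / 1000) ^ 2 * (1 + s) - (2 + s) < ((2455 : ℝ) / 1000) ^ 2 * u := by
      have h1 : (((2455 : ℝ) / 1000) ^ 2 * (1 + s) - (2 + s)) ^ 2 < (((2455 : ℝ) / 1000) ^ 2 * u) ^ 2 := by
        rw [mul_pow, ← pow_mul, hu2]; nlinarith
      exact lt_of_pow_lt_pow_left₀ 2 (by positivity) h1
    nlinarith
  · rw [rotYdagger_lt_iff (by norm_num : (0:ℝ) ≤ 24551 / 10000)]
    have key : ((24551 : ℝ) / 10000) ^ 2 * u < ((24551 : ℝ) / 10000) ^ 2 * (1 + s) - (2 + s) := by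
      have h1 : (((24551 : ℝ) / 10000) ^ 2 * u) ^ 2 < (((24551 : ℝ) / 10000) ^ 2 * (1 + s) - (2 + s)) ^ 2 := by
        rw [mul_pow, ← pow_mul, hu2]; nlinarith
      exact lt_of_pow_lt_pow_left₀ 2 (by nlinarith) h1
    nlinarith

/-- **`2.455 < y_c^rot < 2.4551`** (through the door `hexRotSurfaceYc = y†`). [cite: Beaton2014RotatedHoneycomb, Theorem 1 (arXiv v3 p. 2: "= 2.455…")] -/
theorem hexRotSurfaceYc_mem_Ioo_digits : hexRotSurfaceYc ∈ Set.Ioo ((2455 : ℝ) / 1000) (24551 / 10000) := by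
  rw [hexRotSurfaceYc_eq]; exact rotYdagger_mem_Ioo_digits

/-- The gap between the two orientations' critical surface fugacities: `0.04 < y_c^rot − y_c < 0.041` (`1 + √2 = 2.41421…`).
[cite: Beaton2014RotatedHoneycomb, §1 (arXiv v3 p. 2: 1 + √2 vs 2.455…), Theorem 1; BeatonBousquetMelouDeGierDuminilCopinGuttmann2014, Theorem 2 (arXiv v5 p. 3)] -/
theorem hexRotSurfaceYc_sub_hexSurfaceYc_mem_Ioo : hexRotSurfaceYc - hexSurfaceYc ∈ Set.Ioo ((4 : ℝ) / 100) (41 / 1000) := by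
  obtain ⟨hlo, hhi⟩ := sqrt_two_digits
  obtain ⟨h1, h2⟩ := hexRotSurfaceYc_mem_Ioo_digits
  rw [hexSurfaceYc_eq]
  constructor <;> linarith

end Literature.Probability.RandomPlanarGeometry.SAW.HV
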